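import Summits.BirchSwinnertonDyer.BirchSwinnertonDyer.Theorems.ErratumRoadFiveSelfDualMemberInputs
import Summits.BirchSwinnertonDyer.BirchSwinnertonDyer.Theorems.UniversalToricDescentRoadFFMemberCongruenceOdd
import HarnessLib

/-!
# Route `UniversalToricDescent`, ♭B column at `p = 3` (♭B′ stmt-BirchSwinnertonDyer-27401; K1-at-3 27934 → K1♯†): the Road-FF member
# congruence `e_m^†` at ANY ODD PRIME for the SELF-DUAL module `A_g^†` of a Hida member of weight `k_m ≡ 2 (mod 2(p−1)p^{m−1})`

Width seat bsd-wall-utd-p2-w2 g9 (2026-08-28), brick (B1, part 2) of the kernel† `(5)†: 20711 → 22593† → K1♯† → ♭B′` (pen bsd-wall-pss3x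
sequence T0→T3, 18:50:09Z; lead bsd-wall-utd-p2 g18 holds the core). `--supports stmt-BirchSwinnertonDyer-27401 --as helper`; Theses-free;
theorems only (no definition, no named fact, no instance, no `sorry`).

## What this file proves

`SelfDual.nonempty_memberCongruence_tame_odd` ∕ `SelfDual.nonempty_memberCongruence_odd_of_facts` — for a Hida member
`D : Skinner2016.HidaCongruentMember W p m` of `f_E` (`p ∥ N`, `3 ≤ p`, `m ≥ 1`) whose weight satisfies `2(p−1)p^{m−1} ∣ k_m − 2`:
`((𝒪_m⟦T⟧ ⊗_Λ X^Σ_𝔮(E/K_∞)) ⧸ ((C p)Λ·𝒪_m⟦T⟧)^m) ≃ₗ[𝒪_m⟦T⟧] (XBig κ (A^†_{g_m}|_{Γ_K}) 𝔮 Σ ⧸ ((C p)Λ·𝒪_m⟦T⟧)^m)`, i.e. the tree's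
`RoadFFMember.nonempty_memberCongruence_tame_odd` ∕ `…_odd_of_facts` (lead bsd-wall-utd-p2 g11) with the member module
`D.Δ.cofreeRepOver K` (UNTWISTED `A_{g_m}`, faithful only at `k = 2`) replaced by the erratum's self-dual `D.Δ.selfDualCofreeRepOver K`
([Castella2018Erratum] §2 p. 2: «the self-dual Tate twist … [Nek92, § 3] … `A_g := V_g/T_g`»). Proof = the same abstract assembly
`RoadFFMember.nonempty_memberCongruence` ((b) + Lemma 2.1 + Pontryagin + (SelBC) + (Frob) + (F1)), fed bsd-stepL imc-p1 g24's †-inputs (file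
`ErratumRoadFiveSelfDualMemberInputs`, 2026-08-28): (b†) over `Γ_K` (`SelfDualTwist.exists_torsionCongruence_baseChange_selfDual`, from
(b†) p658384), `SelfDualTwist.hdiv_selfDual` ∕ `hglob_selfDual_erratum` ∕ `hloc_selfDual`. The weight clause is exactly what makes `ε^{1−k_m/2} ≡ 1 (mod p^m)`, so that print's
(b) «`T_f/p^m T_f ≅ T_{f_m}/p^m T_{f_m}` as `𝒪[G_ℚ]`-modules» holds for print's own (self-dual) `T_{f_m}`; Hida theory supplies members in
that sub-progression of weights ([Skinner2016PacificMC] §2.6: «for an integer `k′ > 2` with `k′ ≡ k (mod (p−1)p^c)` … we choose such a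
`k′ = k_m`»).

HONEST FRAMING: theorems only; CONDITIONAL on the named facts displayed as hypotheses (`prop323_XAc_equiv_XBigDecomp`, (SelBC)
`selmerBig_extendScalars_equiv_baseChange`, both PUBLISHED) and on the weight clause; nothing is booked; the anticyclotomic main conjecture
is asserted nowhere; no item is closed; BSD is proved for no curve. Consumer: the self-dual member tower
(`UniversalToricDescentRoadFFCpIntMemberTowerSelfDual`, same seat) and the lead's kernel† for ♭B′.

References: [Castella2018Erratum] §2 (p. 2), Thm. 1.1, (b), Lemma 2.1 and proof of Thm. 1.1 (pp. 1–4); [Skinner2016PacificMC] §2.3 (p. 179),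
§2.6 (2-6-1), §3.1 (a)(b) (p. 192); [SkinnerUrban2014] Prop. 3.2.3, Lemma 3.1.9; [Castella2018] §2.2, Thm. 2.6.
-/

set_option autoImplicit false

noncomputable section

open scoped TensorProduct Classical

open PowerSeries Field IsDedekindDomain NumberField CongruenceSubgroup
open Literature.NumberTheory.GaloisRepresentations Literature.NumberTheory.EllipticCurves
  Literature.NumberTheory.EllipticCurves.ModularForms
  Literature.NumberTheory.EllipticCurves.BigRepModule Literature.NumberTheory.EllipticCurves.BigGaloisRep
  Literature.NumberTheory.EllipticCurves.GreenbergSelmer Literature.NumberTheory.EllipticCurves.Skinner2016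
  Literature.NumberTheory.EllipticCurves.Rank1Residual Literature.NumberTheory.EllipticCurves.Rank1Residual.Typed
  WeierstrassCurve
open scoped MatrixGroups ModularForm
open Summit.BirchSwinnertonDyer.BirchSwinnertonDyer.Theorems

namespace Summit.BirchSwinnertonDyer.Rank1Residual.X11b.RoadFFMember.SelfDual

/-! ### §4 The member congruence `e_m^†` at `3 ≤ p` for the self-dual module -/

section Congruence

variable {W : WeierstrassCurve ℚ} [W.IsElliptic] [W.IsGloballyMinimal] {p : ℕ} [Fact p.Prime] {m : ℕ}
  {K : Type} [Field K] [NumberField K]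

/-- **THE MEMBER CONGRUENCE `e_m^†` AT EVERY `p ≥ 3` FOR THE SELF-DUAL MODULE (tame `Σ`-hypothesis).** For a Hida member `D` of `f_E`
at level `m ≥ 1` with `2(p−1)p^{m−1} ∣ k_m − 2`, coefficient ring `𝒪_m`, `E[p]` irreducible, `K` imaginary quadratic with `p` split, the
X-slot `𝔮 ∣ p` of degree one (`φ : K_𝔮 →+* ℚ_p`), (dec) `E(ℚ_p)[p] = 0`, `Σ` finite away from `p` containing the bad places and those
above `N/p`: `((𝒪_m⟦T⟧ ⊗_Λ X^Σ_𝔮(E/K_∞)) ⧸ ((C p)Λ·𝒪_m⟦T⟧)^m) ≃ₗ[𝒪_m⟦T⟧] (XBig κ (A^†_{g_m}|_{Γ_K}) 𝔮 Σ ⧸ ((C p)Λ·𝒪_m⟦T⟧)^m)`.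
Statement and proof = `RoadFFMember.nonempty_memberCongruence_tame_odd` with the member module `D.Δ.selfDualCofreeRepOver K` and the
†-inputs of bsd-stepL's `ErratumRoadFiveSelfDualMemberInputs` ((b†) over `Γ_K`, `hdiv/hglob/hloc`†). CONDITIONAL on the named facts `hSh` and (SelBC) `hSelBC` and on (Frob) `t₀, b, b'`.
Nothing is booked. [cite: Castella2018Erratum, §2 (p. 2), Thm. 1.1, (b), Lemma 2.1 and proof of Thm. 1.1 (pp. 1–4)]
[cite: Skinner2016PacificMC, §2.6 (2-6-1) (standing `p ≥ 3`), §3.1 (a)(b)] [cite: SkinnerUrban2014, Prop. 3.2.3] -/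
theorem nonempty_memberCongruence_tame_odd (hSh : SkinnerUrban2014.prop323_XAc_equiv_XBigDecomp)
    (hp : 3 ≤ p) (hirr : Irr W p) (hK : IsImaginaryQuadratic K) (hsplit : SatisfiesHeegnerHypothesis p K)
    (𝔮 : HeightOneSpectrum (𝓞 K)) (h𝔮 : ((p : ℕ) : 𝓞 K) ∈ 𝔮.asIdeal) (φ : 𝔮.adicCompletion K →+* ℚ_[p])
    (hiv : ∀ Q : (W.baseChange ℚ_[p]).toAffine.Point, p • Q = 0 → Q = 0)
    (S : Set (HeightOneSpectrum (𝓞 K))) (hSfin : S.Finite) (hSp : ∀ w ∈ S, ((p : ℕ) : 𝓞 K) ∉ w.asIdeal)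
    (hS : ∀ w : HeightOneSpectrum (𝓞 K), w ∉ S → ((p : ℕ) : 𝓞 K) ∉ w.asIdeal →
      (W.baseChange K).HasGoodReductionAt w)
    (hSM : ∀ w : HeightOneSpectrum (𝓞 K), w ∉ S → ((W.conductorNorm ℤ / p : ℕ) : 𝓞 K) ∉ w.asIdeal)
    (κ : ZpExtension K p) (hκ : κ.IsAnticyclotomic) (γ : absoluteGaloisGroup K) [Fact (κ.IsTopGenerator γ)]
    (D : HidaCongruentMember W p m) (hm : 1 ≤ m)
    (hk : (2 * ((p : ℤ) - 1) * (p : ℤ) ^ (m - 1)) ∣ D.k - 2)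
    [TopologicalSpace (IwasawaAlgebra p)]
    [ContinuousSMul (IwasawaAlgebra p) (BigRepModule ℤ_[p] p (PrimaryTorsion (geomPoints (W.baseChange K)) p))]
    [TopologicalSpace (PowerSeries (padicCoeffIntegers D.ι))]
    [ContinuousSMul (PowerSeries (padicCoeffIntegers D.ι)) (BigRepModule (padicCoeffIntegers D.ι) p
      (CoeffExtension ℤ_[p] (padicCoeffIntegers D.ι) (PrimaryTorsion (geomPoints (W.baseChange K)) p)))]
    [ContinuousSMul (PowerSeries (padicCoeffIntegers D.ι)) (BigRepModule (padicCoeffIntegers D.ι) p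
      (Cofree D.Δ.selfDualRep (padicCoeffField D.ι)))]
    (hSelBC : Nonempty (selmerBig κ (ContinuousRep.extendScalars (R := ℤ_[p]) (G := absoluteGaloisGroup K)
        (A := PrimaryTorsion (geomPoints (W.baseChange K)) p) (padicCoeffIntegers D.ι)
        ((W.baseChange K).primaryTorsionGaloisRep p)) 𝔮 S ≃ₗ[PowerSeries (padicCoeffIntegers D.ι)]
      PowerSeries (padicCoeffIntegers D.ι) ⊗[IwasawaAlgebra p]
        selmerBig κ ((W.baseChange K).primaryTorsionGaloisRep p) 𝔮 S))
    {ι' : Type*} [Fintype ι'] (t₀ : padicCoeffIntegers D.ι →ₗ[ℤ_[p]] ℤ_[p]) (b b' : ι' → padicCoeffIntegers D.ι)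
    (hfb : ∀ a : padicCoeffIntegers D.ι, a = ∑ i, t₀ (a * b' i) • b i)
    (hfb' : ∀ a : padicCoeffIntegers D.ι, a = ∑ i, t₀ (a * b i) • b' i) :
    Nonempty ((((PowerSeries (padicCoeffIntegers D.ι)) ⊗[IwasawaAlgebra p]
          AcSelmer.XAc (W.baseChange K) p κ 𝔮 S γ) ⧸
        (((Ideal.span {(C (p : ℤ_[p]) : IwasawaAlgebra p)}).map
            (algebraMap (IwasawaAlgebra p) (PowerSeries (padicCoeffIntegers D.ι)))) ^ m •
          (⊤ : Submodule (PowerSeries (padicCoeffIntegers D.ι))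
            ((PowerSeries (padicCoeffIntegers D.ι)) ⊗[IwasawaAlgebra p] AcSelmer.XAc (W.baseChange K) p κ 𝔮 S γ))))
        ≃ₗ[PowerSeries (padicCoeffIntegers D.ι)]
      (XBig κ (D.Δ.selfDualCofreeRepOver K) 𝔮 S ⧸
        (((Ideal.span {(C (p : ℤ_[p]) : IwasawaAlgebra p)}).map
            (algebraMap (IwasawaAlgebra p) (PowerSeries (padicCoeffIntegers D.ι)))) ^ m •
          (⊤ : Submodule (PowerSeries (padicCoeffIntegers D.ι)) (XBig κ (D.Δ.selfDualCofreeRepOver K) 𝔮 S))))) := by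
  haveI : Module.Free ℤ_[p] (padicCoeffIntegers D.ι) := moduleFree_of_frobData D.ι t₀ b b' hfb
  -- (unr): inertia at every `w ∉ Σ`, `w ∤ p` acts trivially on `E_K[p^∞]` (good reduction there)
  have hunr : ∀ w : HeightOneSpectrum (𝓞 K), w ∉ S → ((p : ℕ) : 𝓞 K) ∉ w.asIdeal →
      ∀ σ : absoluteGaloisGroup (w.adicCompletion K), σ ∈ absInertia (w.adicCompletion K) →
        ∀ P : PrimaryTorsion (geomPoints (W.baseChange K)) p,
          absGaloisRestrict K (w.adicCompletion K) σ • P = P :=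
    fun w hw hpw σ hσ P =>
      BigRep.smul_primaryTorsion_eq_of_mem_absInertia_of_hasGoodReductionAt (W.baseChange K) p (hS w hw hpw)
        hpw hσ P
  -- (F1) at `3 ≤ p`
  have hF1 := nonempty_XAc_equiv_XBig_odd W p K hSh hp hK hsplit 𝔮 h𝔮 S hSfin hSp
    (fun w hw hpw σ P => by
      obtain ⟨σ, hσ⟩ := σ
      rw [WeierstrassCurve.primaryTorsionGaloisRep_apply]
      exact hunr w hw hpw σ hσ P)
    κ hκ γ
  exact nonempty_memberCongruence κ m ((W.baseChange K).primaryTorsionGaloisRep p)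
    (ContinuousRep.extendScalars (R := ℤ_[p]) (G := absoluteGaloisGroup K)
      (A := PrimaryTorsion (geomPoints (W.baseChange K)) p) (padicCoeffIntegers D.ι)
      ((W.baseChange K).primaryTorsionGaloisRep p))
    (D.Δ.selfDualCofreeRepOver K) 𝔮 S hF1 hSelBC t₀ b b' hfb hfb'
    (SelfDualTwist.exists_torsionCongruence_baseChange_selfDual D K hm hk)
    (hdiv_extendScalars_erratum K (padicCoeffIntegers D.ι) (W := W))
    (hglob_extendScalars_erratum K (padicCoeffIntegers D.ι) κ hK hirr m hm)
    (hloc_extendScalars (padicCoeffIntegers D.ι) (W.baseChange K) κ 𝔮 S (geomPoints_baseChange_divisible K (W := W))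
      (BigRep.hdec_geomPoints_of_padicTorsion W p K 𝔮 φ hiv) hunr m hm)
    (SelfDualTwist.hdiv_selfDual D.Δ)
    (SelfDualTwist.hglob_selfDual_erratum D K hm hk κ hK hirr m hm)
    (SelfDualTwist.hloc_selfDual D K hm hk κ 𝔮 S (BigRep.hdec_geomPoints_of_padicTorsion W p K 𝔮 φ hiv) hSM m hm)

/-- **`e_m^†` at every `p ≥ 3` from the NAMED FACTS (F1 = `hSh`) and (SelBC = `hSelBC`), with (Frob) and `Module.Free/Finite ℤ_p 𝒪_m`
discharged by defn-ty1's (T1)** (`HidaCongruentForm.exists_frobeniusData`, `moduleFree_coeffRing`, `moduleFinite_coeffRing`; needs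
`N/p ≠ 0`), for the SELF-DUAL member module under the weight clause `2(p−1)p^{m−1} ∣ k_m − 2`. Same conclusion as
`SelfDual.nonempty_memberCongruence_tame_odd`; †-twin of `RoadFFMember.nonempty_memberCongruence_odd_of_facts`. CONDITIONAL on the two
named facts; nothing booked. [cite: Castella2018Erratum, §2 (p. 2), (b), Lemma 2.1 and proof of Thm. 1.1 (p. 4)]
[cite: Skinner2016PacificMC, §2.3 (p. 179), §2.6 (2-6-1), §3.1 (a)(b)] [cite: SkinnerUrban2014, Prop. 3.2.3] -/
theorem nonempty_memberCongruence_odd_of_facts (hSh : SkinnerUrban2014.prop323_XAc_equiv_XBigDecomp)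
    (hSelBC : Skinner2016.selmerBig_extendScalars_equiv_baseChange)
    (hp : 3 ≤ p) (hirr : Irr W p) (hK : IsImaginaryQuadratic K) (hsplit : SatisfiesHeegnerHypothesis p K)
    (𝔮 : HeightOneSpectrum (𝓞 K)) (h𝔮 : ((p : ℕ) : 𝓞 K) ∈ 𝔮.asIdeal) (φ : 𝔮.adicCompletion K →+* ℚ_[p])
    (hiv : ∀ Q : (W.baseChange ℚ_[p]).toAffine.Point, p • Q = 0 → Q = 0)
    (S : Set (HeightOneSpectrum (𝓞 K))) (hSfin : S.Finite) (hSp : ∀ w ∈ S, ((p : ℕ) : 𝓞 K) ∉ w.asIdeal)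
    (hS : ∀ w : HeightOneSpectrum (𝓞 K), w ∉ S → ((p : ℕ) : 𝓞 K) ∉ w.asIdeal →
      (W.baseChange K).HasGoodReductionAt w)
    (hSM : ∀ w : HeightOneSpectrum (𝓞 K), w ∉ S → ((W.conductorNorm ℤ / p : ℕ) : 𝓞 K) ∉ w.asIdeal)
    (κ : ZpExtension K p) (hκ : κ.IsAnticyclotomic) (γ : absoluteGaloisGroup K) [Fact (κ.IsTopGenerator γ)]
    (D : HidaCongruentMember W p m) (hm : 1 ≤ m)
    (hk : (2 * ((p : ℤ) - 1) * (p : ℤ) ^ (m - 1)) ∣ D.k - 2) [NeZero (W.conductorNorm ℤ / p)]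
    [TopologicalSpace (IwasawaAlgebra p)]
    [ContinuousSMul (IwasawaAlgebra p) (BigRepModule ℤ_[p] p (PrimaryTorsion (geomPoints (W.baseChange K)) p))]
    [TopologicalSpace (PowerSeries (padicCoeffIntegers D.ι))]
    [ContinuousSMul (PowerSeries (padicCoeffIntegers D.ι)) (BigRepModule (padicCoeffIntegers D.ι) p
      (CoeffExtension ℤ_[p] (padicCoeffIntegers D.ι) (PrimaryTorsion (geomPoints (W.baseChange K)) p)))]
    [ContinuousSMul (PowerSeries (padicCoeffIntegers D.ι)) (BigRepModule (padicCoeffIntegers D.ι) p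
      (Cofree D.Δ.selfDualRep (padicCoeffField D.ι)))] :
    Nonempty ((((PowerSeries (padicCoeffIntegers D.ι)) ⊗[IwasawaAlgebra p]
          AcSelmer.XAc (W.baseChange K) p κ 𝔮 S γ) ⧸
        (((Ideal.span {(C (p : ℤ_[p]) : IwasawaAlgebra p)}).map
            (algebraMap (IwasawaAlgebra p) (PowerSeries (padicCoeffIntegers D.ι)))) ^ m •
          (⊤ : Submodule (PowerSeries (padicCoeffIntegers D.ι))
            ((PowerSeries (padicCoeffIntegers D.ι)) ⊗[IwasawaAlgebra p] AcSelmer.XAc (W.baseChange K) p κ 𝔮 S γ))))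
        ≃ₗ[PowerSeries (padicCoeffIntegers D.ι)]
      (XBig κ (D.Δ.selfDualCofreeRepOver K) 𝔮 S ⧸
        (((Ideal.span {(C (p : ℤ_[p]) : IwasawaAlgebra p)}).map
            (algebraMap (IwasawaAlgebra p) (PowerSeries (padicCoeffIntegers D.ι)))) ^ m •
          (⊤ : Submodule (PowerSeries (padicCoeffIntegers D.ι)) (XBig κ (D.Δ.selfDualCofreeRepOver K) 𝔮 S))))) :=
  haveI : Module.Free ℤ_[p] (padicCoeffIntegers D.ι) := D.moduleFree_coeffRing
  haveI : Module.Finite ℤ_[p] (padicCoeffIntegers D.ι) := D.moduleFinite_coeffRing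
  D.exists_frobeniusData.elim fun _n h => h.elim fun t₀ h => h.elim fun b h => h.elim fun b' h =>
    nonempty_memberCongruence_tame_odd hSh hp hirr hK hsplit 𝔮 h𝔮 φ hiv S hSfin hSp hS hSM κ hκ γ D hm hk
      (Skinner2016.nonempty_selmerBig_primaryTorsion_extendScalars_equiv W κ (padicCoeffIntegers D.ι) 𝔮 S hSelBC)
      t₀ b b' h.1 h.2

end Congruence

end Summit.BirchSwinnertonDyer.Rank1Residual.X11b.RoadFFMember.SelfDual

end
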